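import Literature.AlgebraicGeometry.Resolution.CentresAndCoordinates
import Literature.AlgebraicGeometry.Resolution.GenericPointsOfClosure
import Literature.AlgebraicGeometry.Resolution.PatchingMorphismStep
import Literature.AlgebraicGeometry.Dimension.FibreLocalRingDimension
import Literature.AlgebraicGeometry.Motives.RatFnBirationalHartogs
import HarnessLib

/-!
# Dimensions of points of a projective threefold model and Zariski's bad points

Topic: `Literature/AlgebraicGeometry/Resolution`. For a projective model `M` of a function field
`K/k` of transcendence degree `3` (`ProjModel`), and a point `a ∈ M` with the specialization order
of Mathlib (`a ≤ b ↔ b ⤳ a`): `dim 𝒪_{M,a} + dim cl{a} = 3`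
(`coheight a + height a = 3`, from `coheight_add_height_eq_topologicalKrullDim` and
`dim M = trdeg_k K`), points with `dim 𝒪 = 3` are closed, points with `dim 𝒪 = 0` are generic
(`𝒪 = K`), and REGULAR points with `dim 𝒪 ≤ 1` have valuation rings as local rings, hence are
never points of indeterminacy of a rational map to another projective model
(`hasCentre_of_coheight_le_one`; "the fundamental locus has codimension at least two").

**Bad points** (Piltant 2013, Def. 5.4, for `P = P_reg` and the intrinsic indeterminacy locus
`Ind = {a | 𝒪_{M,a} has no centre on B}` of `A ⋯→ B`): for an open `U ⊆ Reg A`, a point `a ∈ U`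
is BAD if `a ∈ Ind` and its closure leaves `U`. Bad points have `dim 𝒪_{A,a} = 2` (they are
generic points of curves), are maximal points of `Ind ∩ U`, hence FINITE in number
(`finite_setOf_isBad`), and when there is none the closure of `Ind ∩ U` stays in `U`
(`closure_inter_subset_of_forall_not_isBad`, the hypothesis of Step 5). All PROVED.

## References

* O. Piltant, RACSAM 107 (2013), proof of Prop. 5.1, Steps 3–5, Def. 5.4. [Piltant2013]
* O. Zariski, P. Samuel, *Commutative Algebra* II (1960), Ch. VI §17. [ZariskiSamuel1960]
* U. Görtz, T. Wedhorn, *Algebraic Geometry I* (2020), Thm. 5.22, Lemma 14.109. [GortzWedhorn2020]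
-/

noncomputable section

open CategoryTheory CategoryTheory.Limits AlgebraicGeometry TopologicalSpace IsLocalRing Order
open Literature.AlgebraicGeometry.Motives

universe u

namespace Literature.AlgebraicGeometry.Resolution

namespace ProjModel

variable {k K : Type u} [Field k] [Field K] [Algebra k K]

/-! ## `dim 𝒪_{M,a} + dim cl{a} = 3` -/

section Dimension

variable (M : ProjModel k K)

/-- **`dim 𝒪_{M,a} + dim cl{a} = 3`** on a projective model of a function field of transcendence
degree three. [cite: GortzWedhorn2020, Thm. 5.22] -/
theorem coheight_add_height_eq_three (htr : Algebra.trdeg k K = 3) (a : M.X) :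
    coheight a + height a = (3 : ℕ∞) := by
  have h := Literature.AlgebraicGeometry.Dimension.coheight_add_height_eq_topologicalKrullDim M.π a
  have h3 : topologicalKrullDim M.X = ((3 : ℕ∞) : WithBot ℕ∞) := by
    rw [M.topologicalKrullDim_eq_of_trdeg htr]; rfl
  rw [h3] at h
  exact WithBot.coe_injective h

/-- The two dimensions as natural numbers summing to `3`. [folklore] -/
theorem exists_nat_coheight_height (htr : Algebra.trdeg k K = 3) (a : M.X) :
    ∃ c h : ℕ, coheight a = c ∧ height a = h ∧ c + h = 3 := by
  have h3 := M.coheight_add_height_eq_three htr a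
  have hc : coheight a ≠ ⊤ := by
    intro htop; rw [htop, top_add] at h3; exact ENat.top_ne_coe 3 (by exact_mod_cast h3)
  have hh : height a ≠ ⊤ := by
    intro htop; rw [htop, add_top] at h3; exact ENat.top_ne_coe 3 (by exact_mod_cast h3)
  refine ⟨(coheight a).toNat, (height a).toNat, (ENat.coe_toNat hc).symm, (ENat.coe_toNat hh).symm, ?_⟩
  rw [← ENat.coe_toNat hc, ← ENat.coe_toNat hh] at h3
  exact_mod_cast h3

/-- `dim 𝒪_{M,a} ≤ 3`. [folklore] -/
theorem coheight_le_three (htr : Algebra.trdeg k K = 3) (a : M.X) : coheight a ≤ 3 := by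
  obtain ⟨c, h, hc, -, hsum⟩ := M.exists_nat_coheight_height htr a
  rw [hc]; exact_mod_cast (by omega : c ≤ 3)

/-- `dim 𝒪_{M,a}` is finite. [folklore] -/
theorem coheight_lt_top (htr : Algebra.trdeg k K = 3) (a : M.X) : coheight a < ⊤ :=
  lt_of_le_of_lt (M.coheight_le_three htr a) (by exact_mod_cast ENat.coe_lt_top 3)

omit [Algebra k K] in
/-- A minimal point of the specialization order is a closed point. [folklore] -/
theorem isClosed_singleton_of_isMin {X : Scheme.{u}} {a : X} (h : IsMin a) :
    IsClosed ({a} : Set X) := by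
  refine isClosed_of_closure_subset fun y hy => ?_
  have hay : a ⤳ y := specializes_iff_mem_closure.mpr hy
  have hle : y ≤ a := hay
  have hya : y ⤳ a := h hle
  exact (hya.antisymm hay).eq

omit [Algebra k K] in
/-- A closed point is a minimal point of the specialization order. [folklore] -/
theorem isMin_of_isClosed_singleton {X : Scheme.{u}} {a : X} (h : IsClosed ({a} : Set X)) :
    IsMin a := by
  intro y hy
  have hay : a ⤳ y := hy
  have hmem : y ∈ closure ({a} : Set X) := specializes_iff_mem_closure.mp hay
  rw [h.closure_eq, Set.mem_singleton_iff] at hmem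
  rw [hmem]

/-- **Points with `dim 𝒪_{M,a} = 3` are closed.** [folklore] -/
theorem isClosed_singleton_of_coheight_eq_three (htr : Algebra.trdeg k K = 3) {a : M.X}
    (ha : coheight a = 3) : IsClosed ({a} : Set M.X) := by
  apply isClosed_singleton_of_isMin
  rw [← height_eq_zero]
  obtain ⟨c, h, hc, hh, hsum⟩ := M.exists_nat_coheight_height htr a
  rw [hc] at ha
  have : c = 3 := by exact_mod_cast ha
  rw [hh]; exact_mod_cast (by omega : h = 0)

/-- Closed points have `dim 𝒪_{M,a} = 3`. [folklore] -/
theorem coheight_eq_three_of_isClosed_singleton (htr : Algebra.trdeg k K = 3) {a : M.X}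
    (ha : IsClosed ({a} : Set M.X)) : coheight a = 3 := by
  have h0 : height a = 0 := height_eq_zero.mpr (isMin_of_isClosed_singleton ha)
  obtain ⟨c, h, hc, hh, hsum⟩ := M.exists_nat_coheight_height htr a
  rw [hh] at h0
  have : h = 0 := by exact_mod_cast h0
  rw [hc]; exact_mod_cast (by omega : c = 3)

/-- **In the closure of a point `x` with `dim 𝒪_{M,x} = 2` every other point is closed** (a curve
consists of its generic point and closed points). [folklore] -/
theorem eq_or_isClosed_of_mem_closure (htr : Algebra.trdeg k K = 3) {x c : M.X}
    (hx : coheight x = 2) (hc : c ∈ closure ({x} : Set M.X)) : c = x ∨ IsClosed ({c} : Set M.X) := by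
  by_cases hcx : c = x
  · exact Or.inl hcx
  right
  apply M.isClosed_singleton_of_coheight_eq_three htr
  have hxc : x ⤳ c := specializes_iff_mem_closure.mpr hc
  have hlt : c < x :=
    lt_iff_le_not_ge.mpr ⟨hxc, fun hcx' => hcx ((show c ⤳ x from hcx').antisymm hxc).eq⟩
  have h1 : coheight x < coheight c := coheight_strictAnti hlt (M.coheight_lt_top htr x)
  rw [hx] at h1
  have h2 := M.coheight_le_three htr c
  obtain ⟨d, -, hd, -, -⟩ := M.exists_nat_coheight_height htr c
  rw [hd] at h1 h2 ⊢
  have h1' : 2 < d := by exact_mod_cast h1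
  have h2' : d ≤ 3 := by exact_mod_cast h2
  exact_mod_cast (by omega : d = 3)

/-- **A point of another model over a point `x` with `dim 𝒪_{A,x} = 2` has `dim 𝒪 ≤ 2`**: the
image of a closed point under the (closed) morphism of models would be closed. [folklore] -/
theorem coheight_le_two_of_map_eq (htr : Algebra.trdeg k K = 3) {A B : ProjModel k K}
    (η : B.Hom A) {t : B.X} {x : A.X} (hx : coheight x = 2) (ht : η.f t = x) : coheight t ≤ 2 := by
  obtain ⟨c, h, hc, hh, hsum⟩ := B.exists_nat_coheight_height htr t
  rw [hc]
  by_contra hlt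
  have hc3 : c = 3 := by
    have : ¬ (c : ℕ∞) ≤ 2 := hlt
    have : ¬ c ≤ 2 := fun h' => this (by exact_mod_cast h')
    omega
  have hclosed : IsClosed ({t} : Set B.X) :=
    B.isClosed_singleton_of_coheight_eq_three htr (by rw [hc, hc3]; rfl)
  have hclosed' : IsClosed ({x} : Set A.X) := by
    have := η.f.isClosedMap _ hclosed
    rwa [Set.image_singleton, ht] at this
  have := A.coheight_eq_three_of_isClosed_singleton htr hclosed'
  rw [hx] at this
  exact absurd this (by decide)

/-! ## Points with small local rings are never points of indeterminacy -/

/-- **`dim 𝒪_{M,a} = 0`: `a` is the generic point and `𝒪_{M,a} = K`.** [folklore] -/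
theorem stalkSubring_eq_top_of_coheight_eq_zero {a : M.X} (ha : coheight a = 0) :
    M.stalkSubring a = ⊤ := by
  have hmax : IsMax a := coheight_eq_zero.mp ha
  have hgen : genericPoint M.X ⤳ a := (genericPoint_spec M.X).specializes (Set.mem_univ a)
  have hle : a ≤ genericPoint M.X := hgen
  have hge : genericPoint M.X ≤ a := hmax hle
  have heq : a = genericPoint M.X := ((show a ⤳ genericPoint M.X from hge).antisymm hgen).eq
  rw [heq]
  exact M.stalkSubring_genericPoint

/-- **A regular point with `dim 𝒪_{M,a} ≤ 1` has a valuation ring as local ring** (a field or a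
discrete valuation ring): every `z ∈ K` has `z ∈ 𝒪_{M,a}` or `z⁻¹ ∈ 𝒪_{M,a}`. [folklore] -/
theorem mem_or_inv_mem_stalkSubring_of_coheight_le_one {a : M.X}
    [IsRegularLocalRing (M.X.presheaf.stalk a)] (ha : coheight a ≤ 1) (z : K) :
    z ∈ M.stalkSubring a ∨ z⁻¹ ∈ M.stalkSubring a := by
  have hdim : ringKrullDim (M.X.presheaf.stalk a) ≤ 1 := by
    rw [ringKrullDim_stalk_eq_coheight]; exact_mod_cast ha
  haveI : ValuationRing (M.X.presheaf.stalk a) :=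
    RatFn.valuationRing_of_isRegularLocalRing_of_ringKrullDim_le_one _ hdim
  let h : M.X.functionField := M.funFieldIso.inv.hom z
  have hz : M.funFieldIso.hom.hom h = z := by
    rw [← CommRingCat.comp_apply, Iso.inv_hom_id, CommRingCat.id_apply]
  rcases ValuationRing.isInteger_or_isInteger (M.X.presheaf.stalk a) h with ⟨t, ht⟩ | ⟨t, ht⟩
  · left
    rw [← hz, ← isRegularAt_iff_mem_stalkSubring]
    exact ⟨t, ht⟩
  · right
    rw [← hz, ← map_inv₀, ← isRegularAt_iff_mem_stalkSubring]
    exact ⟨t, ht⟩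

/-- **Regular points with `dim 𝒪 ≤ 1` are never points of indeterminacy**: `𝒪_{A,a}` is a
valuation ring of `K/k`, which has a centre on every projective model ("the fundamental locus of
a birational map to a normal variety has codimension `≥ 2`", here on the regular locus).
[cite: ZariskiSamuel1960, Ch. VI §17] -/
theorem hasCentre_of_coheight_le_one (A B : ProjModel k K) {a : A.X}
    [IsRegularLocalRing (A.X.presheaf.stalk a)] (ha : coheight a ≤ 1) :
    B.HasCentre (A.stalkSubring a) :=
  B.hasCentre_of_mem_or_inv_mem (A.mem_or_inv_mem_stalkSubring_of_coheight_le_one ha)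
    (A.algebraMap_mem_stalkSubring a)

/-- **Points of indeterminacy in the regular locus have `dim 𝒪 ≥ 2`.** [cite: Piltant2013, proof of Prop. 5.1, Step 3] -/
theorem two_le_coheight_of_not_hasCentre (A B : ProjModel k K) {a : A.X}
    [IsRegularLocalRing (A.X.presheaf.stalk a)] (ha : ¬ B.HasCentre (A.stalkSubring a)) :
    2 ≤ coheight a := by
  by_contra h
  have h1 : coheight a ≤ 1 := by
    rw [not_le] at h
    exact Order.le_of_lt_add_one (by exact_mod_cast h)
  exact ha (hasCentre_of_coheight_le_one A B h1)

end Dimension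

/-! ## Bad points -/

section Bad

variable (A B : ProjModel k K) (U : A.X.Opens)

/-- **Bad point** (Piltant 2013, Def. 5.4, for `P = P_reg`, with the intrinsic indeterminacy
locus): `a ∈ U` whose local ring has no centre on `B` and whose closure leaves `U`.
[cite: Piltant2013, Def. 5.4] -/
def IsBad (a : A.X) : Prop :=
  a ∈ U ∧ ¬ B.HasCentre (A.stalkSubring a) ∧ ¬ closure ({a} : Set A.X) ⊆ (U : Set A.X)

variable {A B U}

/-- Regularity of the local rings at the points of an open inside the regular locus. [folklore] -/
theorem isRegularLocalRing_of_mem (hU : (U : Set A.X) ⊆ Scheme.regularLocus A.X) {a : A.X}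
    (ha : a ∈ U) : IsRegularLocalRing (A.X.presheaf.stalk a) := hU ha

/-- **Bad points have `dim 𝒪_{A,a} = 2`.** [cite: Piltant2013, Def. 5.4] -/
theorem IsBad.coheight_eq_two (htr : Algebra.trdeg k K = 3)
    (hU : (U : Set A.X) ⊆ Scheme.regularLocus A.X) {a : A.X} (h : IsBad A B U a) :
    coheight a = 2 := by
  obtain ⟨haU, hnc, hcl⟩ := h
  haveI := isRegularLocalRing_of_mem hU haU
  have h2 := two_le_coheight_of_not_hasCentre A B hnc
  obtain ⟨c, h', hc, -, hsum⟩ := A.exists_nat_coheight_height htr a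
  rw [hc] at h2 ⊢
  have h2' : 2 ≤ c := by exact_mod_cast h2
  have hc3' : c ≤ 3 := by omega
  have hc3 : c ≠ 3 := fun h3 => hcl (by
    rw [(A.isClosed_singleton_of_coheight_eq_three htr (by rw [hc, h3]; rfl)).closure_eq,
      Set.singleton_subset_iff]
    exact haU)
  exact_mod_cast (by omega : c = 2)

/-- **Bad points are maximal points of `Ind ∩ U`**: a point of indeterminacy in `U` generizing a
bad point equals it. [cite: Piltant2013, proof of Prop. 5.1, Step 3] -/
theorem IsBad.eq_of_specializes (htr : Algebra.trdeg k K = 3)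
    (hU : (U : Set A.X) ⊆ Scheme.regularLocus A.X) {a y : A.X} (h : IsBad A B U a) (hyU : y ∈ U)
    (hy : ¬ B.HasCentre (A.stalkSubring y)) (hya : y ⤳ a) : y = a := by
  by_contra hne
  haveI := isRegularLocalRing_of_mem hU hyU
  have hlt : a < y := lt_iff_le_not_ge.mpr ⟨hya, fun hay => hne (hya.antisymm hay).eq⟩
  have h1 : coheight y < coheight a := coheight_strictAnti hlt (A.coheight_lt_top htr y)
  rw [h.coheight_eq_two htr hU] at h1
  have h2 := two_le_coheight_of_not_hasCentre A B hy
  exact absurd (lt_of_le_of_lt h2 h1) (lt_irrefl _)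

/-- Two bad points one of which specializes to the other are equal. [folklore] -/
theorem IsBad.eq_of_isBad_of_specializes (htr : Algebra.trdeg k K = 3)
    (hU : (U : Set A.X) ⊆ Scheme.regularLocus A.X) {a y : A.X} (h : IsBad A B U a)
    (hy : IsBad A B U y) (hya : y ⤳ a) : y = a :=
  h.eq_of_specializes htr hU hy.1 hy.2.1 hya

/-- **Finiteness of bad points.** [cite: Piltant2013, proof of Prop. 5.1, Step 3] -/
theorem finite_setOf_isBad (htr : Algebra.trdeg k K = 3)
    (hU : (U : Set A.X) ⊆ Scheme.regularLocus A.X) : {a : A.X | IsBad A B U a}.Finite := by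
  refine (finite_setOf_maximal_inter (isClosed_setOf_not_hasCentre A B) U.isOpen).subset ?_
  intro a ha
  exact ⟨⟨ha.2.1, ha.1⟩, fun y hy hya => ha.eq_of_specializes htr hU hy.2 hy.1 hya⟩

/-- **No bad points: the closure of `Ind ∩ U` stays in `U`** (the hypothesis of Step 5).
[cite: Piltant2013, proof of Prop. 5.1, Step 5] -/
theorem closure_inter_subset_of_forall_not_isBad (hno : ∀ a, ¬ IsBad A B U a) :
    closure ({a : A.X | ¬ B.HasCentre (A.stalkSubring a)} ∩ (U : Set A.X)) ⊆ U := by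
  intro y hy
  obtain ⟨ξ, ⟨hξI, hξU⟩, hξy⟩ :=
    exists_mem_inter_specializes_of_mem_closure (isClosed_setOf_not_hasCentre A B) U.isOpen hy
  have hcl : closure ({ξ} : Set A.X) ⊆ U := by
    by_contra h
    exact hno ξ ⟨hξU, hξI, h⟩
  exact hcl (specializes_iff_mem_closure.mp hξy)

end Bad

end ProjModel

end Literature.AlgebraicGeometry.Resolution

end
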